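import Summits.AtomisticToContinuum.BoseEinsteinCondensation.Theses.BECHardSphereReduction
import Summits.AtomisticToContinuum.BoseEinsteinCondensation.Theorems.BECInfraredBoundAssembly

/-!
# BECHardSphereReduction — the zero-mode support feeds the hard-sphere crux

Route `route-AtomisticToContinuum-BECHardSphereReduction`, two-layer plan
"HardSphereBEC ⇐ HardSphereZeroMode → HardSphereScaling → HardSphereBEC".
We prove exactly that implication between the route's declarations:

* `sideLength_mul_pow_three` : `L_N(ρ a³) = L_N(ρ) / a` (the hard-sphere diameter as unit of length);
* `hardSphereBEC_of_zeroMode_of_scaling` :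
  `HardSphereZeroMode → HardSphereScaling → HardSphereBEC`.

Given `a > 0` put `ρ₀ := η₁ / a³`; for `0 < ρ < ρ₀` the reduced density `η := ρ a³ < η₁` gets from
`HardSphereZeroMode` a constant `c` and, eventually in `N`, a slack `δ > 0` below which every
near-minimiser of the unit-hard-sphere energy in the box of side `L_N(η)` occupies the normalised
constant mode `φ₀ = L^{-3/2}·1_{Λ_L}` at least `cN` times; `occupation ≤ maxOccupation`
(`φ₀` measurable and normalised, `BECInfraredBoundAssembly`) and `le_condensateNumber` turn this into
`ofReal (cN) ≤ condensateNumber HS₁ N (L_N(η))`, and `HardSphereScaling` with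
`L_N(ρ)/a = L_N(η)` identifies the right-hand side with `condensateNumber HS_a N (L_N(ρ))`.
-/

noncomputable section

namespace Summit.AtomisticToContinuum.BoseEinsteinCondensation.Theorems

open MeasureTheory ENNReal Filter Literature.MathematicalPhysics.QuantumManyBody.BoseGas
open Summit.AtomisticToContinuum.BoseEinsteinCondensation.Theses.BECHardSphereReduction

/-- Measuring lengths in hard-sphere diameters: `L_N(ρ a³) = L_N(ρ) / a` for `a > 0`, `ρ > 0`,
since `(N/(ρ a³))^{1/3} = (N/ρ)^{1/3} (a⁻³)^{1/3}`. [folklore] -/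
theorem sideLength_mul_pow_three {ρ a : ℝ} (hρ : 0 < ρ) (ha : 0 < a) (N : ℕ) :
    sideLength (ρ * a ^ 3) N = sideLength ρ N / a := by
  unfold sideLength
  have h1 : (N : ℝ) / (ρ * a ^ 3) = (N : ℝ) / ρ * (a⁻¹) ^ 3 := by
    field_simp
  rw [h1, Real.mul_rpow (div_nonneg N.cast_nonneg hρ.le) (pow_nonneg (inv_nonneg.2 ha.le) 3),
    div_eq_mul_inv]
  congr 1
  rw [← Real.rpow_natCast a⁻¹ 3, ← Real.rpow_mul (inv_nonneg.2 ha.le)]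
  norm_num

/-- **The support item does its job** (two-layer plan of the route, glue of the `bec_of_zeroMode`
pattern): slice delocalisation of the unit-hard-sphere near-minimisers in the constant mode
(`HardSphereZeroMode`) and the exact scale covariance of the hard-sphere family
(`HardSphereScaling`) imply dilute hard-sphere BEC for every diameter (`HardSphereBEC`), with
`ρ₀(a) := η₁ / a³` and the same constant `c(ρ a³)`. [folklore] -/
theorem hardSphereBEC_of_zeroMode_of_scaling (hZ : HardSphereZeroMode) (hS : HardSphereScaling) :
    HardSphereBEC := by
  obtain ⟨η₁, hη₁, hZ⟩ := hZ
  intro a ha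
  have ha3 : 0 < a ^ 3 := pow_pos ha 3
  refine ⟨η₁ / a ^ 3, div_pos hη₁ ha3, fun ρ hρ hρlt => ?_⟩
  have hη : 0 < ρ * a ^ 3 := mul_pos hρ ha3
  have hηlt : ρ * a ^ 3 < η₁ := (lt_div_iff₀ ha3).1 hρlt
  obtain ⟨c, hc, hev⟩ := hZ (ρ * a ^ 3) hη hηlt
  refine ⟨c, hc, ?_⟩
  filter_upwards [hev, eventually_gt_atTop 0] with N hN hNpos
  obtain ⟨δ, hδ, hΨ⟩ := hN
  have hL : 0 < sideLength (ρ * a ^ 3) N :=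
    Real.rpow_pos_of_pos (div_pos (Nat.cast_pos.mpr hNpos) hη) _
  rw [hS a (sideLength ρ N) N ha, ← sideLength_mul_pow_three hρ ha N]
  exact le_condensateNumber _ hδ fun Ψ hE =>
    (hΨ Ψ hE).trans (occupation_le_maxOccupation _
      (_root_.AtomisticToContinuum.BECInfraredBound.aestronglyMeasurable_constMode _)
      (_root_.AtomisticToContinuum.BECInfraredBound.lintegral_constMode_sq hL))

end Summit.AtomisticToContinuum.BoseEinsteinCondensation.Theorems

end
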